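import Mathlib
import Summits.RiemannHypothesis.RiemannHypothesis.Theorems.WeilParityOffLineParityDetectionStubEvenOffLineCauchySchwarz
import Summits.RiemannHypothesis.RiemannHypothesis.Theorems.WeilParityOffLineParityDetectionTorusGramIntegrals
import Summits.RiemannHypothesis.RiemannHypothesis.Theorems.WeilParityOffLineParityDetectionTorusGramForms
import Summits.RiemannHypothesis.RiemannHypothesis.Theorems.WeilParityOffLineParityDetectionTorusGramCutoff
import Summits.RiemannHypothesis.RiemannHypothesis.Theorems.WeilParityOffLineParityDetectionTorusGramAssembly
import Summits.RiemannHypothesis.RiemannHypothesis.Theorems.WeilParityOffLineParityDetectionStubTorusTopHeavySeparated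
import HarnessLib

/-!
# Crux `OffLineParityDetection`, line `registered`: stub RESIDUAL-TWO-LIGHT

Route `WeilParity`, crux `…Theses.WeilParity.OffLineParityDetection` (item
stmt-RiemannHypothesis-15431), line `registered`; this file proves the registered stub
`stub_residualTwoLight` BY NAME (`ζ`-free real analysis on `L²(0, ∞)`).  Setting: `η₀ > 0`, a top
layer `T ⊂ {Re ρ = 1/2 + η₀}` with positive weights whose absolute ordinates take two values
`g₁ ≠ g₂`, class weights `M_j = Σ_{|Im ρ| = g_j} w`, `|z_j| = √(η₀² + g_j²)`, and one class LIGHT: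
`M_k |z_h| (1 + η₀/|z_k|) < M_h η₀`.  Proof (RESIDUAL-analysis §2.1, Corollary LIGHT in its crudest
form): FOLD `gain(a, f) = Σ_j M_j(⟨f,c_j⟩² - ⟨f,s_j⟩²)`, `c_j = e^{-η₀u}cos(g_j(u-a))`,
`s_j = e^{-η₀u}sin(g_j(u-a))` (`…TorusGramForms`); PHASE `2g_h a = arctan(g_h/η₀)`, where
`⟨c_h,s_h⟩ = 0`, `‖c_h‖² - ‖s_h‖² = h_a(2g_h) = 1/(2|z_h|)` (`…TorusGramIntegrals`); DANGER
`-gain ≤ (M_h‖s_h‖² + M_k‖s_k‖²)‖f‖² =: D‖f‖²` (Cauchy–Schwarz); GAIN of `c_h`: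
`gain(a,c_h)/‖c_h‖² - D ≥ M_h/(2|z_h|) - 2M_k‖s_k‖²` and `2‖s_k‖² = 1/(2η₀) - h_a(2g_k) ≤
1/(2η₀) + 1/(2|z_k|)`, so the light hypothesis is exactly strict top-heaviness of `c_h`; CUT-OFF
of `c_h` by dominated convergence (`…TorusGramCutoff`).
-/

set_option linter.dupNamespace false

noncomputable section

namespace Summit.RiemannHypothesis.RiemannHypothesis.Theorems.WeilParityOffLineParityDetection

open MeasureTheory Set Filter
open scoped ComplexConjugate
open Literature.NumberTheory.LFunctions

/-! ## The optimal phase of one ordinate -/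

/-- **Optimal phase of one ordinate**: with `θ = arctan(g/η)` (`η > 0`),
`2η cos θ + 2g sin θ = 2√(η² + g²)` and `2g cos θ - 2η sin θ = 0`. [folklore] -/
theorem resLight_phase {η : ℝ} (hη : 0 < η) (g : ℝ) :
    2 * η * Real.cos (Real.arctan (g / η)) + 2 * g * Real.sin (Real.arctan (g / η)) =
        2 * Real.sqrt (η ^ 2 + g ^ 2) ∧
      2 * g * Real.cos (Real.arctan (g / η)) - 2 * η * Real.sin (Real.arctan (g / η)) = 0 := by
  -- polar pattern adapted from Literature/Barriers/AtomisticToContinuum (ofReal_add_mul_I_eq_polar)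
  have hpq : 0 < η ^ 2 + g ^ 2 := by positivity
  have hsq : Real.sqrt (1 + (g / η) ^ 2) = Real.sqrt (η ^ 2 + g ^ 2) / η := by
    rw [show 1 + (g / η) ^ 2 = (η ^ 2 + g ^ 2) / η ^ 2 by field_simp, Real.sqrt_div hpq.le,
      Real.sqrt_sq hη.le]
  have hr : 0 < Real.sqrt (η ^ 2 + g ^ 2) := Real.sqrt_pos.mpr hpq
  have hrne : Real.sqrt (η ^ 2 + g ^ 2) ≠ 0 := hr.ne'
  have hzz : Real.sqrt (η ^ 2 + g ^ 2) ^ 2 = η ^ 2 + g ^ 2 := Real.sq_sqrt hpq.le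
  have hcos : Real.sqrt (η ^ 2 + g ^ 2) * Real.cos (Real.arctan (g / η)) = η := by
    rw [Real.cos_arctan, hsq]
    field_simp
  have hsin : Real.sqrt (η ^ 2 + g ^ 2) * Real.sin (Real.arctan (g / η)) = g := by
    rw [Real.sin_arctan, hsq]
    field_simp
  exact ⟨mul_left_cancel₀ hrne (by linear_combination 2 * η * hcos + 2 * g * hsin - 2 * hzz),
    mul_left_cancel₀ hrne (by linear_combination 2 * g * hcos - 2 * η * hsin)⟩

/-- **Size bound** `|h_a(2g)| ≤ 1/(2√(η² + g²))` for the closed form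
`h_a(ω) = (2η cos(ωa) + ω sin(ωa))/(4η² + ω²)` (from `h² + q² = 1/(4η² + ω²)`). [folklore] -/
theorem resLight_closedForm_abs_le {η : ℝ} (hη : 0 < η) (g a : ℝ) {H : ℝ → ℝ}
    (hH : ∀ ω, H ω = (2 * η * Real.cos (ω * a) + ω * Real.sin (ω * a)) / (4 * η ^ 2 + ω ^ 2)) :
    |H (2 * g)| ≤ 1 / (2 * Real.sqrt (η ^ 2 + g ^ 2)) := by
  have hpq : 0 < η ^ 2 + g ^ 2 := by positivity
  have hzz : Real.sqrt (η ^ 2 + g ^ 2) ^ 2 = η ^ 2 + g ^ 2 := Real.sq_sqrt hpq.le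
  have hr : 0 < Real.sqrt (η ^ 2 + g ^ 2) := Real.sqrt_pos.mpr hpq
  have h := torusSep_closedForm_sq_add_sq hη (2 * g) a
  refine abs_le_of_sq_le_sq ?_ (by positivity)
  rw [hH]
  calc ((2 * η * Real.cos (2 * g * a) + 2 * g * Real.sin (2 * g * a)) / (4 * η ^ 2 + (2 * g) ^ 2)) ^ 2
      ≤ 1 / (4 * η ^ 2 + (2 * g) ^ 2) := by
        nlinarith [h, sq_nonneg ((2 * g * Real.cos (2 * g * a) - 2 * η * Real.sin (2 * g * a)) /
          (4 * η ^ 2 + (2 * g) ^ 2))]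
    _ = (1 / (2 * Real.sqrt (η ^ 2 + g ^ 2))) ^ 2 := by
        rw [div_pow, one_pow, mul_pow, mul_pow, hzz]
        congr 1
        ring

/-! ## Gram data of one ordinate's cosine / sine pair -/

/-- **Gram data of one ordinate** (`η > 0`, phase point `a`, `c_g = e^{-ηu} cos(g(u-a))`,
`s_g = e^{-ηu} sin(g(u-a))` on `(0, ∞)`): `‖c_g‖² = (h_a(0) + h_a(2g))/2`,
`‖s_g‖² = (h_a(0) - h_a(2g))/2`, `⟨c_g, s_g⟩ = (q_a(0) + q_a(2g))/2`, and the Cauchy–Schwarz bound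
`⟨c_g, s_h⟩² ≤ ‖c_g‖² ‖s_h‖²`. [folklore] -/
theorem resLight_gram_data {η : ℝ} (hη : 0 < η) (a g h : ℝ) {H Q : ℝ → ℝ}
    (hH : ∀ ω, H ω = (2 * η * Real.cos (ω * a) + ω * Real.sin (ω * a)) / (4 * η ^ 2 + ω ^ 2))
    (hQ : ∀ ω, Q ω = (ω * Real.cos (ω * a) - 2 * η * Real.sin (ω * a)) / (4 * η ^ 2 + ω ^ 2)) :
    ∫ u in Ioi (0 : ℝ), (Real.exp (-(η * u)) * Real.cos (g * (u - a))) ^ 2 = (H 0 + H (2 * g)) / 2 ∧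
    ∫ u in Ioi (0 : ℝ), (Real.exp (-(η * u)) * Real.sin (g * (u - a))) ^ 2 = (H 0 - H (2 * g)) / 2 ∧
    ∫ u in Ioi (0 : ℝ), Real.exp (-(η * u)) * Real.cos (g * (u - a)) *
        (Real.exp (-(η * u)) * Real.cos (g * (u - a))) = (H 0 + H (2 * g)) / 2 ∧
    ∫ u in Ioi (0 : ℝ), Real.exp (-(η * u)) * Real.cos (g * (u - a)) *
        (Real.exp (-(η * u)) * Real.sin (g * (u - a))) = (Q 0 + Q (2 * g)) / 2 ∧
    (∫ u in Ioi (0 : ℝ), Real.exp (-(η * u)) * Real.cos (g * (u - a)) *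
        (Real.exp (-(η * u)) * Real.sin (h * (u - a)))) ^ 2 ≤
      (∫ u in Ioi (0 : ℝ), (Real.exp (-(η * u)) * Real.cos (g * (u - a))) ^ 2) *
        ∫ u in Ioi (0 : ℝ), (Real.exp (-(η * u)) * Real.sin (h * (u - a))) ^ 2 := by
  have hcc := torusSep_gram_cc hη a g g hH
  have hss := torusSep_gram_ss hη a g g hH
  have hcs := torusSep_gram_cs hη a g g hQ
  rw [sub_self, ← two_mul] at hcc hss hcs
  -- integrability of the products on `(0, ∞)`
  have hi_cc := torusSep_integrableOn_prod hη (k₁ := fun u ↦ Real.cos (g * (u - a)))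
    (k₂ := fun u ↦ Real.cos (g * (u - a))) (by fun_prop) (by fun_prop)
    (fun u ↦ Real.abs_cos_le_one _) (fun u ↦ Real.abs_cos_le_one _)
  have hi_ss := torusSep_integrableOn_prod hη (k₁ := fun u ↦ Real.sin (h * (u - a)))
    (k₂ := fun u ↦ Real.sin (h * (u - a))) (by fun_prop) (by fun_prop)
    (fun u ↦ Real.abs_sin_le_one _) (fun u ↦ Real.abs_sin_le_one _)
  have hi_cs := torusSep_integrableOn_prod hη (k₁ := fun u ↦ Real.cos (g * (u - a)))
    (k₂ := fun u ↦ Real.sin (h * (u - a))) (by fun_prop) (by fun_prop)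
    (fun u ↦ Real.abs_cos_le_one _) (fun u ↦ Real.abs_sin_le_one _)
  refine ⟨?_, ?_, hcc, hcs, ?_⟩
  · rw [← hcc]
    exact integral_congr_ae (ae_of_all _ fun u ↦ sq _)
  · rw [← hss]
    exact integral_congr_ae (ae_of_all _ fun u ↦ sq _)
  · exact sq_integral_mul_le (hi_cc.congr (ae_of_all _ fun u ↦ (sq _).symm))
      (hi_ss.congr (ae_of_all _ fun u ↦ (sq _).symm)) hi_cs

/-- **Cauchy–Schwarz for one pairing**: `⟨f, e^{-ηu} k(g(u-a))⟩² ≤ ‖f‖² ‖e^{-ηu} k(g(u-a))‖²` on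
`(0, ∞)` for continuous compactly supported `f` and continuous `|k| ≤ 1`. [folklore] -/
theorem resLight_pairing_sq_le {η : ℝ} (hη : 0 < η) (a g : ℝ) (k : ℝ → ℝ) (hk : Continuous k)
    (hk1 : ∀ v, |k v| ≤ 1) {f : ℝ → ℝ} (hf : Continuous f) (hfs : HasCompactSupport f) :
    (∫ u in Ioi (0 : ℝ), f u * (Real.exp (-(η * u)) * k (g * (u - a)))) ^ 2 ≤
      (∫ u in Ioi (0 : ℝ), f u ^ 2) *
        ∫ u in Ioi (0 : ℝ), (Real.exp (-(η * u)) * k (g * (u - a))) ^ 2 := by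
  have hf2 : Integrable (fun u ↦ f u ^ 2) (volume.restrict (Ioi (0 : ℝ))) :=
    (((hf.mul hf).integrable_of_hasCompactSupport hfs.mul_right).integrableOn (s := Ioi 0)).congr
      (ae_of_all _ fun u ↦ (sq (f u)).symm)
  have hk2 := torusSep_integrableOn_prod hη (k₁ := fun u ↦ k (g * (u - a)))
    (k₂ := fun u ↦ k (g * (u - a))) (by fun_prop) (by fun_prop) (fun u ↦ hk1 _) (fun u ↦ hk1 _)
  have hfk : Integrable (fun u ↦ f u * (Real.exp (-(η * u)) * k (g * (u - a))))
      (volume.restrict (Ioi (0 : ℝ))) :=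
    ((hf.mul (by fun_prop)).integrable_of_hasCompactSupport hfs.mul_right).integrableOn
  exact sq_integral_mul_le hf2 (hk2.congr (ae_of_all _ fun u ↦ (sq _).symm)) hfk

/-! ## The two-class core: a heavy class and a light class -/

/-- The margin: `D E < Γ`, `E > 0` give `δ > 0` with `(D + δ) E ≤ Γ`. [folklore] -/
theorem resLight_margin {D E Γ : ℝ} (hE : 0 < E) (h : D * E < Γ) :
    ∃ δ : ℝ, 0 < δ ∧ (D + δ) * E ≤ Γ :=
  ⟨(Γ - D * E) / E, div_pos (by linarith) hE, by rw [add_mul, div_mul_cancel₀ _ hE.ne']; linarith⟩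

/-- Arithmetic of the gain of the ideal profile: if `M_h‖s_h‖² + 2M_k‖s_k‖² < M_h‖c_h‖²` then
`(M_h‖s_h‖² + M_k‖s_k‖²)‖c_h‖² < M_h‖c_h‖⁴ + M_k(⟨c_h,c_k⟩² - ⟨c_h,s_k⟩²)` (Cauchy–Schwarz
`⟨c_h,s_k⟩² ≤ ‖c_h‖²‖s_k‖²`). [folklore] -/
theorem resLight_gain_arith {D Nc Ns Nsk Pck Psk Mh Mk : ℝ} (hD : D = Mh * Ns + Mk * Nsk)
    (hMk : 0 ≤ Mk) (hNc0 : 0 < Nc) (hCS : Psk ^ 2 ≤ Nc * Nsk)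
    (h2 : Mh * Ns + 2 * Mk * Nsk < Mh * Nc) :
    D * Nc < Mh * (Nc ^ 2 - ((0 + 0) / 2) ^ 2) + Mk * (Pck ^ 2 - Psk ^ 2) := by
  have h4 : Mk * Psk ^ 2 ≤ Mk * (Nc * Nsk) := mul_le_mul_of_nonneg_left hCS hMk
  have h5 : 0 ≤ Mk * Pck ^ 2 := mul_nonneg hMk (sq_nonneg _)
  have h6 := mul_lt_mul_of_pos_left h2 hNc0
  rw [hD]
  nlinarith [h4, h5, h6]

/-- Arithmetic of the danger bound: `-(M_h(C_h² - S_h²) + M_k(C_k² - S_k²)) ≤ (M_h N_s + M_k N_sk) F`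
when `S_h² ≤ F N_s`, `S_k² ≤ F N_sk`, `M_h, M_k ≥ 0`. [folklore] -/
theorem resLight_danger_arith {Mh Mk Ns Nsk F Ch Sh Ck Sk : ℝ} (hMh : 0 ≤ Mh) (hMk : 0 ≤ Mk)
    (hSh : Sh ^ 2 ≤ F * Ns) (hSk : Sk ^ 2 ≤ F * Nsk) :
    -(Mh * (Ch ^ 2 - Sh ^ 2) + Mk * (Ck ^ 2 - Sk ^ 2)) ≤ (Mh * Ns + Mk * Nsk) * F := by
  have e1 := mul_le_mul_of_nonneg_left hSh hMh
  have e2 := mul_le_mul_of_nonneg_left hSk hMk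
  have e3 : 0 ≤ Mh * Ch ^ 2 := mul_nonneg hMh (sq_nonneg _)
  have e4 : 0 ≤ Mk * Ck ^ 2 := mul_nonneg hMk (sq_nonneg _)
  nlinarith [e1, e2, e3, e4]

/-- **Two classes, one light** (RESIDUAL-analysis §2.1, Corollary LIGHT): for `η > 0`, ordinates
`g_h, g_k`, weights `M_h` and `M_k ≥ 0` with `M_k √(η²+g_h²) (1 + η/√(η²+g_k²)) < M_h η`, the
two-class form `M_h(⟨f,c_h⟩² - ⟨f,s_h⟩²) + M_k(⟨f,c_k⟩² - ⟨f,s_k⟩²)` is top-heavy at the phase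
point `a = arctan(g_h/η)/(2g_h)`: danger bound `D = M_h‖s_h‖² + M_k‖s_k‖²`, gaining profile a
cut-off of `c_h`. [folklore] -/
theorem resLight_core {η : ℝ} (hη : 0 < η) (gh gk : ℝ) {Mh Mk : ℝ} (hMk : 0 ≤ Mk)
    (hlt : Mk * Real.sqrt (η ^ 2 + gh ^ 2) * (1 + η / Real.sqrt (η ^ 2 + gk ^ 2)) < Mh * η) :
    ∃ δ : ℝ, 0 < δ ∧ ∃ a : ℝ, ∃ D : ℝ, 0 ≤ D ∧
      (∀ f : ℝ → ℝ, Continuous f → HasCompactSupport f →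
        -(Mh * ((∫ u in Ioi (0 : ℝ), f u * (Real.exp (-(η * u)) * Real.cos (gh * (u - a)))) ^ 2 -
            (∫ u in Ioi (0 : ℝ), f u * (Real.exp (-(η * u)) * Real.sin (gh * (u - a)))) ^ 2) +
          Mk * ((∫ u in Ioi (0 : ℝ), f u * (Real.exp (-(η * u)) * Real.cos (gk * (u - a)))) ^ 2 -
            (∫ u in Ioi (0 : ℝ), f u * (Real.exp (-(η * u)) * Real.sin (gk * (u - a)))) ^ 2)) ≤
          D * ∫ u in Ioi (0 : ℝ), f u ^ 2) ∧
      (∃ f : ℝ → ℝ, ContDiff ℝ (⊤ : ℕ∞) f ∧ HasCompactSupport f ∧ tsupport f ⊆ Ici 0 ∧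
        0 < ∫ u in Ioi (0 : ℝ), f u ^ 2 ∧
        (D + δ) * ∫ u in Ioi (0 : ℝ), f u ^ 2 ≤
          Mh * ((∫ u in Ioi (0 : ℝ), f u * (Real.exp (-(η * u)) * Real.cos (gh * (u - a)))) ^ 2 -
              (∫ u in Ioi (0 : ℝ), f u * (Real.exp (-(η * u)) * Real.sin (gh * (u - a)))) ^ 2) +
            Mk * ((∫ u in Ioi (0 : ℝ), f u * (Real.exp (-(η * u)) * Real.cos (gk * (u - a)))) ^ 2 -
              (∫ u in Ioi (0 : ℝ), f u * (Real.exp (-(η * u)) * Real.sin (gk * (u - a)))) ^ 2)) := by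
  /- ### moduli, the heavy weight, the key numeric inequality -/
  have hzh2 : 0 < η ^ 2 + gh ^ 2 := by positivity
  have hzk2 : 0 < η ^ 2 + gk ^ 2 := by positivity
  obtain ⟨hc, hs⟩ := resLight_phase hη gh
  set zh : ℝ := Real.sqrt (η ^ 2 + gh ^ 2) with hzh
  set zk : ℝ := Real.sqrt (η ^ 2 + gk ^ 2) with hzk
  have hzh0 : 0 < zh := Real.sqrt_pos.2 hzh2
  have hzk0 : 0 < zk := Real.sqrt_pos.2 hzk2
  obtain ⟨hzhne, hzkne, hηne⟩ : zh ≠ 0 ∧ zk ≠ 0 ∧ η ≠ 0 := ⟨hzh0.ne', hzk0.ne', hη.ne'⟩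
  have hzz : zh ^ 2 = η ^ 2 + gh ^ 2 := Real.sq_sqrt hzh2.le
  have h0 : 0 ≤ Mk * zh * (1 + η / zk) := by positivity
  have hMh : 0 < Mh := lt_of_mul_lt_mul_right (by linarith : 0 * η < Mh * η) hη.le
  have hkey : Mk * (1 / (2 * η) + 1 / (2 * zk)) < Mh * (1 / (2 * zh)) := by
    have e1 : Mk * (1 / (2 * η) + 1 / (2 * zk)) = Mk * zh * (1 + η / zk) / (2 * η * zh) := by
      field_simp
    have e2 : Mh * (1 / (2 * zh)) = Mh * η / (2 * η * zh) := by field_simp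
    rw [e1, e2]
    exact div_lt_div_of_pos_right hlt (by positivity)
  /- ### the phase point -/
  set θ : ℝ := Real.arctan (gh / η) with hθ
  set a : ℝ := θ / (2 * gh) with ha
  have hga : 2 * gh * a = θ := by
    rcases eq_or_ne gh 0 with h0 | h0
    · rw [show θ = 0 by rw [hθ, h0, zero_div, Real.arctan_zero], h0, mul_zero, zero_mul]
    · rw [ha]
      field_simp
  /- ### closed forms at the phase point -/
  set H : ℝ → ℝ := fun ω ↦
    (2 * η * Real.cos (ω * a) + ω * Real.sin (ω * a)) / (4 * η ^ 2 + ω ^ 2) with hHdef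
  set Q : ℝ → ℝ := fun ω ↦
    (ω * Real.cos (ω * a) - 2 * η * Real.sin (ω * a)) / (4 * η ^ 2 + ω ^ 2) with hQdef
  have hH : ∀ ω, H ω = (2 * η * Real.cos (ω * a) + ω * Real.sin (ω * a)) / (4 * η ^ 2 + ω ^ 2) :=
    fun ω ↦ rfl
  have hQ : ∀ ω, Q ω = (ω * Real.cos (ω * a) - 2 * η * Real.sin (ω * a)) / (4 * η ^ 2 + ω ^ 2) :=
    fun ω ↦ rfl
  have hH0 : H 0 = 1 / (2 * η) := by
    rw [hH, zero_mul, Real.cos_zero, Real.sin_zero, div_eq_div_iff (by positivity) (by positivity)]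
    ring
  have hQ0 : Q 0 = 0 := by rw [hQ]; simp
  have hHh : H (2 * gh) = 1 / (2 * zh) := by
    rw [hH, hga, hc, div_eq_div_iff (by positivity) (by positivity)]
    linear_combination 4 * hzz
  have hQh : Q (2 * gh) = 0 := by rw [hQ, hga, hs, zero_div]
  have hHk : |H (2 * gk)| ≤ 1 / (2 * zk) := resLight_closedForm_abs_le hη gk a hH
  /- ### Gram data -/
  obtain ⟨hNc, hNs, hPcc, hPcs, hCS⟩ := resLight_gram_data hη a gh gk hH hQ
  obtain ⟨-, hNsk, -, -, -⟩ := resLight_gram_data hη a gk gh hH hQ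
  have hNs0 : 0 ≤ ∫ u in Ioi (0 : ℝ), (Real.exp (-(η * u)) * Real.sin (gh * (u - a))) ^ 2 :=
    integral_nonneg fun u ↦ sq_nonneg _
  have hNsk0 : 0 ≤ ∫ u in Ioi (0 : ℝ), (Real.exp (-(η * u)) * Real.sin (gk * (u - a))) ^ 2 :=
    integral_nonneg fun u ↦ sq_nonneg _
  -- freeze the five Gram numbers
  set Nc := ∫ u in Ioi (0 : ℝ), (Real.exp (-(η * u)) * Real.cos (gh * (u - a))) ^ 2 with hNcdef
  set Ns := ∫ u in Ioi (0 : ℝ), (Real.exp (-(η * u)) * Real.sin (gh * (u - a))) ^ 2 with hNsdef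
  set Nsk := ∫ u in Ioi (0 : ℝ), (Real.exp (-(η * u)) * Real.sin (gk * (u - a))) ^ 2 with hNskdef
  set Pck := ∫ u in Ioi (0 : ℝ), Real.exp (-(η * u)) * Real.cos (gh * (u - a)) *
    (Real.exp (-(η * u)) * Real.cos (gk * (u - a))) with hPckdef
  set Psk := ∫ u in Ioi (0 : ℝ), Real.exp (-(η * u)) * Real.cos (gh * (u - a)) *
    (Real.exp (-(η * u)) * Real.sin (gk * (u - a))) with hPskdef
  clear_value Nc Ns Nsk Pck Psk
  have hNc0 : 0 < Nc := by rw [hNc, hH0, hHh]; positivity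
  -- the danger constant
  have hD0 : 0 ≤ Mh * Ns + Mk * Nsk := by positivity
  set D : ℝ := Mh * Ns + Mk * Nsk with hD
  clear_value D
  /- ### strict top-heaviness of the ideal profile `c_h` -/
  have h1 : 2 * Mk * Nsk ≤ Mk * (1 / (2 * η) + 1 / (2 * zk)) := by
    have hk' : -(1 / (2 * zk)) ≤ H (2 * gk) := (abs_le.1 hHk).1
    have : 2 * Nsk ≤ 1 / (2 * η) + 1 / (2 * zk) := by rw [hNsk, hH0]; linarith
    nlinarith [this, hMk]
  have h2 : Mh * Ns + 2 * Mk * Nsk < Mh * Nc := by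
    have h3 : Mh * Nc - Mh * Ns = Mh * (1 / (2 * zh)) := by rw [hNc, hNs, hHh]; ring
    linarith [hkey, h1, h3]
  have hstrict0 : D * Nc < Mh * (Nc ^ 2 - ((0 + 0) / 2) ^ 2) + Mk * (Pck ^ 2 - Psk ^ 2) :=
    resLight_gain_arith hD hMk hNc0 hCS h2
  /- ### the gaining profile: a cut-off of `c_h` -/
  set p : ℝ → ℝ := fun u ↦ Real.exp (-(η * u)) * Real.cos (gh * (u - a)) with hpdef
  have hp1 : ContDiff ℝ (⊤ : ℕ∞) p := by rw [hpdef]; fun_prop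
  have hpA : ∀ u, 0 < u → |p u| ≤ 1 * Real.exp (-(η * u)) := fun u _ ↦ by
    rw [one_mul]; exact torusSep_abs_damped_le Real.cos Real.abs_cos_le_one u _
  have hp2 : 0 < ∫ u in Ioi (0 : ℝ), p u ^ 2 := by rw [hpdef]; dsimp only; rw [← hNcdef]; exact hNc0
  obtain ⟨f₀, hf₀1, hf₀2, hf₀3, hf₀pos, hf₀strict⟩ := torusSep_cutoff_select hη hp1 hpA hp2
    (fun (i : Bool) u ↦ Real.exp (-(η * u)) * Real.cos (cond i gh gk * (u - a)))
    (fun (i : Bool) u ↦ Real.exp (-(η * u)) * Real.sin (cond i gh gk * (u - a)))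
    (fun i ↦ by fun_prop) (fun i ↦ by fun_prop)
    (fun i u _ ↦ torusSep_abs_damped_le Real.cos Real.abs_cos_le_one u _)
    (fun i u _ ↦ torusSep_abs_damped_le Real.sin Real.abs_sin_le_one u _) (fun i ↦ cond i Mh Mk)
    D (by
      simp only [Fintype.sum_bool, Bool.cond_true, Bool.cond_false]
      rw [hpdef]
      dsimp only
      rw [hPcc, hPcs, hQ0, hQh, ← hNc, ← hNcdef, ← hPckdef, ← hPskdef]
      exact hstrict0)
  simp only [Fintype.sum_bool, Bool.cond_true, Bool.cond_false] at hf₀strict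
  /- ### the margin, the danger bound, the conclusion -/
  obtain ⟨δ, hδ, hgain⟩ := resLight_margin hf₀pos hf₀strict
  refine ⟨δ, hδ, a, D, hD0, fun f hf hfs ↦ ?_, f₀, hf₀1, hf₀2, hf₀3, hf₀pos, hgain⟩
  have hSh := resLight_pairing_sq_le hη a gh Real.sin Real.continuous_sin Real.abs_sin_le_one hf hfs
  have hSk := resLight_pairing_sq_le hη a gk Real.sin Real.continuous_sin Real.abs_sin_le_one hf hfs
  rw [← hNsdef] at hSh
  rw [← hNskdef] at hSk
  rw [hD]
  exact resLight_danger_arith hMh.le hMk hSh hSk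

/-! ## Folding the form onto the two classes -/

/-- A weighted sum over `T` of a function of `|Im ρ|`, when `|Im ρ|` takes only the two values
`g₁ ≠ g₂` on `T`, is `M₁ X(g₁) + M₂ X(g₂)` with the class weights `M_j = Σ_{|Im ρ| = g_j} w(ρ)`.
[folklore] -/
theorem resLight_sum_two_classes (T : Finset ℂ) (w : ℂ → ℝ) {g₁ g₂ : ℝ} (hne : g₁ ≠ g₂)
    (hcls : ∀ ρ ∈ T, |ρ.im| = g₁ ∨ |ρ.im| = g₂) (X : ℝ → ℝ) :
    ∑ ρ ∈ T, w ρ * X |ρ.im| =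
      (∑ ρ ∈ T.filter (fun ρ : ℂ ↦ |ρ.im| = g₁), w ρ) * X g₁ +
        (∑ ρ ∈ T.filter (fun ρ : ℂ ↦ |ρ.im| = g₂), w ρ) * X g₂ := by
  rw [← Finset.sum_filter_add_sum_filter_not T (fun ρ : ℂ ↦ |ρ.im| = g₁), Finset.sum_mul,
    Finset.sum_mul]
  have hfilt : T.filter (fun ρ : ℂ ↦ ¬ |ρ.im| = g₁) = T.filter (fun ρ : ℂ ↦ |ρ.im| = g₂) :=
    Finset.filter_congr fun ρ hρ ↦
      ⟨fun h ↦ (hcls ρ hρ).resolve_left h, fun h h' ↦ hne (h'.symm.trans h)⟩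
  rw [hfilt]
  congr 1 <;> exact Finset.sum_congr rfl fun ρ hρ ↦ by rw [(Finset.mem_filter.1 hρ).2]

/-- **Fold onto the two classes**: for a continuous compactly supported real `f`, `Re ρ = 1/2 + η`
on `T` and `|Im ρ| ∈ {g₁, g₂}` on `T` (`g₁ ≠ g₂`),
`Σ_T w Re(e^{2i(Im ρ)a} F_f(ρ)²) = Σ_{j=1,2} M_j (⟨f, c_{g_j}⟩² - ⟨f, s_{g_j}⟩²)`. [folklore] -/
theorem resLight_fold {η : ℝ} (T : Finset ℂ) (hTre : ∀ ρ ∈ T, ρ.re = 1 / 2 + η) (w : ℂ → ℝ)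
    {g₁ g₂ : ℝ} (hne : g₁ ≠ g₂) (hcls : ∀ ρ ∈ T, |ρ.im| = g₁ ∨ |ρ.im| = g₂) (a : ℝ)
    {f : ℝ → ℝ} (hf : Continuous f) (hfs : HasCompactSupport f) :
    ∑ ρ ∈ T, w ρ * (Complex.exp (2 * (ρ.im : ℂ) * (a : ℂ) * Complex.I) *
        (∫ u in Ioi (0 : ℝ), (f u : ℂ) * Complex.exp (-((ρ - 1 / 2) * (u : ℂ)))) ^ 2).re =
      (∑ ρ ∈ T.filter (fun ρ : ℂ ↦ |ρ.im| = g₁), w ρ) *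
          ((∫ u in Ioi (0 : ℝ), f u * (Real.exp (-(η * u)) * Real.cos (g₁ * (u - a)))) ^ 2 -
            (∫ u in Ioi (0 : ℝ), f u * (Real.exp (-(η * u)) * Real.sin (g₁ * (u - a)))) ^ 2) +
        (∑ ρ ∈ T.filter (fun ρ : ℂ ↦ |ρ.im| = g₂), w ρ) *
          ((∫ u in Ioi (0 : ℝ), f u * (Real.exp (-(η * u)) * Real.cos (g₂ * (u - a)))) ^ 2 -
            (∫ u in Ioi (0 : ℝ), f u * (Real.exp (-(η * u)) * Real.sin (g₂ * (u - a)))) ^ 2) := by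
  rw [Finset.sum_congr rfl fun ρ hρ ↦ by rw [torusSep_re_phase_laplace_sq_abs hf hfs (hTre ρ hρ) a]]
  exact resLight_sum_two_classes T w hne hcls (fun g ↦
    (∫ u in Ioi (0 : ℝ), f u * (Real.exp (-(η * u)) * Real.cos (g * (u - a)))) ^ 2 -
      (∫ u in Ioi (0 : ℝ), f u * (Real.exp (-(η * u)) * Real.sin (g * (u - a)))) ^ 2)

/-! ## The registered stub -/

/-- Stub **RESIDUAL-TWO-LIGHT** of crux `OffLineParityDetection` (line `registered`), `ζ`-free:
a top layer with exactly two absolute ordinates `0 ≤ g₁ < g₂` one of whose classes is LIGHT —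
class weights `M₁, M₂` with `M₂ √(η₀²+g₁²)(1 + η₀/√(η₀²+g₂²)) < M₁ η₀` or the symmetric
inequality — is top-heavy, at the heavy class's optimal phase `a = arctan(g_h/η₀)/(2 g_h)`
(danger bound `D = M_h‖s_h‖² + M_k‖s_k‖²`, gaining profile a cut-off of `e^{-η₀u} cos(g_h(u-a))`);
see the module docstring for the proof. [folklore] -/
theorem stub_residualTwoLight :
    ∀ η₀ : ℝ, 0 < η₀ → ∀ T : Finset ℂ, T.Nonempty → (∀ ρ ∈ T, ρ.re = 1 / 2 + η₀) →
      ∀ w : ℂ → ℝ, (∀ ρ ∈ T, 0 < w ρ) →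
      ∀ g₁ g₂ : ℝ, 0 ≤ g₁ → g₁ < g₂ → (∀ ρ ∈ T, |ρ.im| = g₁ ∨ |ρ.im| = g₂) →
      ((∑ ρ ∈ T.filter (fun ρ : ℂ ↦ |ρ.im| = g₂), w ρ) * Real.sqrt (η₀ ^ 2 + g₁ ^ 2) *
            (1 + η₀ / Real.sqrt (η₀ ^ 2 + g₂ ^ 2)) <
          (∑ ρ ∈ T.filter (fun ρ : ℂ ↦ |ρ.im| = g₁), w ρ) * η₀ ∨
        (∑ ρ ∈ T.filter (fun ρ : ℂ ↦ |ρ.im| = g₁), w ρ) * Real.sqrt (η₀ ^ 2 + g₂ ^ 2) *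
            (1 + η₀ / Real.sqrt (η₀ ^ 2 + g₁ ^ 2)) <
          (∑ ρ ∈ T.filter (fun ρ : ℂ ↦ |ρ.im| = g₂), w ρ) * η₀) →
      ∃ δ : ℝ, 0 < δ ∧ ∃ a : ℝ, ∃ D : ℝ, 0 ≤ D ∧
        (∀ f : ℝ → ℝ, ContDiff ℝ (⊤ : ℕ∞) f → HasCompactSupport f → tsupport f ⊆ Set.Ici 0 →
          -(∑ ρ ∈ T, w ρ * (Complex.exp (2 * (ρ.im : ℂ) * (a : ℂ) * Complex.I) *
              (∫ u in Set.Ioi (0 : ℝ), (f u : ℂ) * Complex.exp (-((ρ - 1 / 2) * (u : ℂ)))) ^ 2).re)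
            ≤ D * ∫ u in Set.Ioi (0 : ℝ), f u ^ 2) ∧
        (∃ f : ℝ → ℝ, ContDiff ℝ (⊤ : ℕ∞) f ∧ HasCompactSupport f ∧ tsupport f ⊆ Set.Ici 0 ∧
          0 < ∫ u in Set.Ioi (0 : ℝ), f u ^ 2 ∧
          (D + δ) * ∫ u in Set.Ioi (0 : ℝ), f u ^ 2 ≤
            ∑ ρ ∈ T, w ρ * (Complex.exp (2 * (ρ.im : ℂ) * (a : ℂ) * Complex.I) *
              (∫ u in Set.Ioi (0 : ℝ), (f u : ℂ) * Complex.exp (-((ρ - 1 / 2) * (u : ℂ)))) ^ 2).re) := by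
  intro η hη T _ hTre w hw g₁ g₂ _ hg₁₂ hcls hlight
  have hM₁ : 0 ≤ ∑ ρ ∈ T.filter (fun ρ : ℂ ↦ |ρ.im| = g₁), w ρ :=
    Finset.sum_nonneg fun ρ hρ ↦ (hw ρ (Finset.mem_filter.1 hρ).1).le
  have hM₂ : 0 ≤ ∑ ρ ∈ T.filter (fun ρ : ℂ ↦ |ρ.im| = g₂), w ρ :=
    Finset.sum_nonneg fun ρ hρ ↦ (hw ρ (Finset.mem_filter.1 hρ).1).le
  have hfold := fun a : ℝ ↦ fun f : ℝ → ℝ ↦ fun hf : Continuous f ↦ fun hfs : HasCompactSupport f ↦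
    resLight_fold T hTre w hg₁₂.ne hcls a hf hfs
  rcases hlight with hA | hB
  · -- class 1 heavy, class 2 light
    obtain ⟨δ, hδ, a, D, hD, hdanger, f₀, hf₀1, hf₀2, hf₀3, hf₀pos, hgain⟩ :=
      resLight_core hη g₁ g₂ hM₂ hA
    refine ⟨δ, hδ, a, D, hD, fun f hf hfs _ ↦ ?_, f₀, hf₀1, hf₀2, hf₀3, hf₀pos, ?_⟩
    · rw [hfold a f hf.continuous hfs]
      exact hdanger f hf.continuous hfs
    · rw [hfold a f₀ hf₀1.continuous hf₀2]
      exact hgain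
  · -- class 2 heavy, class 1 light
    obtain ⟨δ, hδ, a, D, hD, hdanger, f₀, hf₀1, hf₀2, hf₀3, hf₀pos, hgain⟩ :=
      resLight_core hη g₂ g₁ hM₁ hB
    refine ⟨δ, hδ, a, D, hD, fun f hf hfs _ ↦ ?_, f₀, hf₀1, hf₀2, hf₀3, hf₀pos, ?_⟩
    · rw [hfold a f hf.continuous hfs]
      have h := hdanger f hf.continuous hfs
      linarith
    · rw [hfold a f₀ hf₀1.continuous hf₀2]
      linarith

end Summit.RiemannHypothesis.RiemannHypothesis.Theorems.WeilParityOffLineParityDetection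

end
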